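import Literature.NumberTheory.EllipticCurves.FormalGroupLaurentPoints
import Literature.NumberTheory.EllipticCurves.FormalGroupDictionaryProofs
import Literature.NumberTheory.EllipticCurves.FormalGroupNegOmegaProofs
import HarnessLib

/-!
# Translation of the formal point by an integral point: the `t`-expansions of `x(P₀ + P(t))`, `y(P₀ + P(t))`
# (de Shalit II.4.9, proof of (i): «compute its t-expansions, using [Ta] (14) and the addition law on a cubic»)

Topic `NumberTheory/EllipticCurves` (DEFINITIONS with bodies + their algebraic API; no named fact, no instance).
For a Weierstrass equation `W` over ANY commutative ring `R` and a pair `(x₀, y₀) ∈ R²` (an `R`-integral affine point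
`P₀`), the formal point `P(t) = (x(t), y(t)) = (X(t)/t², −X(t)/t³)` (`X = formalXMulSq = 1 − a₁t − a₂t² − ⋯`, Tate's
(14) / Silverman AEC IV.1) and the chord through `P₀` and `P(t)` have
  slope `ℓ = (y₀ − y(t))/(x₀ − x(t)) = −u/t`,  `u := (X + y₀t³)·(X − x₀t²)⁻¹ ∈ R⟦t⟧ˣ` (`translateSlopeNum`),
  `x(P₀ + P(t)) = ℓ² + a₁ℓ − a₂ − x₀ − x(t) = (u² − a₁tu − X − (a₂ + x₀)t²)/t²`  (`translateX`),
  `y(P₀ + P(t)) = −(ℓ(x₃ − x₀) + y₀) − a₁x₃ − a₃ = u·(x₃ − x₀)/t − y₀ − a₁x₃ − a₃`       (`translateY`),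
and the point of this file is de Shalit's observation (II.4.9, proof of (i), with 1.11 (6′)): **both are POWER SERIES in `t`
with coefficients in `R` — polynomials in `x₀, y₀, a₁, …, a₆` — with constant term `x(P₀ + P(0)) = x₀`**: the numerator
`u² − a₁tu − X − (a₂ + x₀)t²` is `≡ 0 (mod t²)` and `x₃ − x₀ ≡ 0 (mod t)` identically (`coeff_translateXAux_zero/one`,
`constantCoeff_translateX`).  Contents: the definitions `translateDen`, `translateNum`, `translateSlopeNum`, `translateXAux`,
`translateX`, `translateXSubDivX`, `translateY`; the identities `translateDen_mul_translateSlopeNum` (`D·u = N`),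
`X_sq_mul_translateX` (`t²·x₃ = u² − a₁tu − X − (a₂ + x₀)t²`), `constantCoeff_translateX` (`x₃(0) = x₀`),
`X_mul_translateXSubDivX` (`t·H = x₃ − x₀`), `translateY_def'`; and `map_translate*` (everything commutes with ring maps —
so over a subring `R ⊂ K` the `K`-expansions have coefficients in `R`: 𝔓-INTEGRALITY of the `t`-expansion when `x₀, y₀, aᵢ`
are 𝔓-integral).  That these series ARE the coordinates of `P₀ + P(t)` in `W(k⸨t⸩)` is `FormalGroupTranslationLaurentProofs`.
Cell `bsd-print-cf2`, seat `bsd-line-cf2c-w4` g12 (measure lane, B6 ingredient (ii-α)); no summit statement is proved.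

## References
* [deShalit1987] E. de Shalit, *Iwasawa theory of elliptic curves with complex multiplication* (1987), II §4.9 Proposition,
  proof of (i) (p. 62–63), II §1.11 (6′), (23′).
* [SilvermanAEC2009] J. H. Silverman, *The Arithmetic of Elliptic Curves*, 2nd ed. (2009), III.2.3 (group law), IV.1
  (`x(z), y(z)`), IV.1.1.
* [Tate1974] J. Tate, *The arithmetic of elliptic curves*, Invent. Math. 23 (1974), §3 (14).
-/

noncomputable section

open scoped Classical
open PowerSeries Literature.NumberTheory.EllipticCurves

namespace WeierstrassCurve

variable {R : Type*} [CommRing R] (W : WeierstrassCurve R) (x₀ y₀ : R)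

/-! ### The definitions -/

/-- `D := X − x₀t² = t²(x(t) − x₀)`, `X = formalXMulSq`. [cite: deShalit1987, II §4.9 (proof of (i))] -/
def translateDen : R⟦X⟧ := W.formalXMulSq - C x₀ * X ^ 2

/-- `N := X + y₀t³ = −t³(y(t) − y₀)`. [cite: deShalit1987, II §4.9 (proof of (i))] -/
def translateNum : R⟦X⟧ := W.formalXMulSq + C y₀ * X ^ 3

/-- `u := N·D⁻¹ = 1 + ⋯`, so that the slope of the chord through `P₀ = (x₀, y₀)` and `P(t)` is `ℓ = −u/t`.
[cite: deShalit1987, II §4.9 (proof of (i))] [cite: SilvermanAEC2009, III.2.3] -/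
def translateSlopeNum : R⟦X⟧ := W.translateNum y₀ * PowerSeries.invOfUnit (W.translateDen x₀) 1

/-- `G := u² − a₁tu − X − (a₂ + x₀)t² = t²·x(P₀ + P(t))`. [cite: deShalit1987, II §4.9 (proof of (i))] [cite: SilvermanAEC2009, III.2.3] -/
def translateXAux : R⟦X⟧ :=
  W.translateSlopeNum x₀ y₀ ^ 2 - C W.a₁ * X * W.translateSlopeNum x₀ y₀ - W.formalXMulSq - C (W.a₂ + x₀) * X ^ 2

/-- ★ **`x(P₀ + P(t)) ∈ R⟦t⟧`**: the `t`-expansion of the `x`-coordinate of the translate of the formal point by the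
integral point `P₀ = (x₀, y₀)` — `G/t²` (the two lowest coefficients of `G` vanish, `coeff_translateXAux_zero/one`).
[cite: deShalit1987, II §4.9 Proposition (i) (proof)] [cite: SilvermanAEC2009, III.2.3, IV.1] -/
def translateX : R⟦X⟧ := PowerSeries.mk fun n => coeff (n + 2) (W.translateXAux x₀ y₀)

/-- `H := (x(P₀ + P(t)) − x₀)/t ∈ R⟦t⟧` (`x(P₀ + P(0)) = x₀`). [cite: deShalit1987, II §4.9 (proof of (i))] -/
def translateXSubDivX : R⟦X⟧ := PowerSeries.mk fun n => coeff (n + 1) (W.translateX x₀ y₀)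

/-- ★ **`y(P₀ + P(t)) ∈ R⟦t⟧`**: `y₃ = −(ℓ(x₃ − x₀) + y₀) − a₁x₃ − a₃` with `ℓ(x₃ − x₀) = −u·H`.
[cite: deShalit1987, II §4.9 Proposition (i) (proof)] [cite: SilvermanAEC2009, III.2.3, IV.1] -/
def translateY : R⟦X⟧ :=
  W.translateSlopeNum x₀ y₀ * W.translateXSubDivX x₀ y₀ - C y₀ - C W.a₁ * W.translateX x₀ y₀ - C W.a₃

/-! ### Low coefficients and the defining identities -/

/-- `D(0) = 1`. [cite: SilvermanAEC2009, IV.1.1] -/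
theorem constantCoeff_translateDen : constantCoeff (W.translateDen x₀) = 1 := by
  simp [translateDen, constantCoeff_formalXMulSq]

/-- `N(0) = 1`. [cite: SilvermanAEC2009, IV.1.1] -/
theorem constantCoeff_translateNum : constantCoeff (W.translateNum y₀) = 1 := by
  simp [translateNum, constantCoeff_formalXMulSq]

/-- `D·D⁻¹ = 1`. [cite: SilvermanAEC2009, IV.1.1] -/
theorem translateDen_mul_invOfUnit : W.translateDen x₀ * PowerSeries.invOfUnit (W.translateDen x₀) 1 = 1 :=
  PowerSeries.mul_invOfUnit _ _ (by rw [constantCoeff_translateDen, Units.val_one])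

/-- **`D·u = N`** (`u = N/D`). [cite: deShalit1987, II §4.9 (proof of (i))] -/
theorem translateDen_mul_translateSlopeNum : W.translateDen x₀ * W.translateSlopeNum x₀ y₀ = W.translateNum y₀ := by
  rw [translateSlopeNum, mul_left_comm, translateDen_mul_invOfUnit, mul_one]

/-- `u(0) = 1`. [cite: SilvermanAEC2009, III.2.3] -/
theorem constantCoeff_translateSlopeNum : constantCoeff (W.translateSlopeNum x₀ y₀) = 1 := by
  have h := congrArg constantCoeff (W.translateDen_mul_translateSlopeNum x₀ y₀)
  rwa [map_mul, constantCoeff_translateDen, one_mul, constantCoeff_translateNum] at h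

/-- `[t¹]D = −a₁`. [cite: SilvermanAEC2009, IV.1.1] -/
theorem coeff_one_translateDen : coeff 1 (W.translateDen x₀) = -W.a₁ := by
  simp [translateDen, coeff_one_formalXMulSq, coeff_X_pow]

/-- `[t¹]N = −a₁`. [cite: SilvermanAEC2009, IV.1.1] -/
theorem coeff_one_translateNum : coeff 1 (W.translateNum y₀) = -W.a₁ := by
  simp [translateNum, coeff_one_formalXMulSq, coeff_X_pow]

/-- `[z²] X = −a₂` for `X = z²x(z) = 1 − a₁z − a₂z² − ⋯` (as in `FormalGroupQuasiPeriodMulDefectCongruenceProofs`, reproved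
here to keep the imports light). [cite: SilvermanAEC2009, IV.1.1] -/
private theorem coeff_two_formalXMulSq' : coeff 2 W.formalXMulSq = -W.a₂ := by
  have h0 : constantCoeff W.formalXMulSq = 1 := W.constantCoeff_formalXMulSq
  have h1 : coeff 1 W.formalXMulSq = -W.a₁ := W.coeff_one_formalXMulSq
  have hw0 : constantCoeff W.formalW = 0 := W.constantCoeff_formalW
  have hw1 : coeff 1 W.formalW = 0 := W.coeff_formalW_of_lt_three (by norm_num)
  have hX2 : coeff 1 ((X : R⟦X⟧) ^ 2) = 0 := by rw [coeff_X_pow, if_neg (by norm_num)]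
  have hX3 : coeff 1 ((X : R⟦X⟧) ^ 3) = 0 := by rw [coeff_X_pow, if_neg (by norm_num)]
  have e : W.formalXMulSq = W.formalXMulSq * W.formalXMulSq + X * (C W.a₁ * W.formalXMulSq +
      C W.a₂ * X * W.formalXMulSq + C W.a₃ * X ^ 2 + C W.a₄ * X ^ 3 + C W.a₆ * X ^ 2 * W.formalW) := by
    linear_combination W.formalXMulSq_fixedPoint
  have h := congrArg (coeff (1 + 1)) e
  rw [map_add, coeff_succ_X_mul, coeff_mul, Finset.Nat.sum_antidiagonal_eq_sum_range_succ_mk,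
    Finset.sum_range_succ, Finset.sum_range_succ, Finset.sum_range_succ, Finset.sum_range_zero] at h
  simp only [zero_add, Nat.reduceAdd, Nat.sub_self, Nat.add_one_sub_one, coeff_zero_eq_constantCoeff, h0, h1,
    map_add, map_mul, coeff_C_mul, PowerSeries.coeff_one_mul, coeff_one_X, mul_one,
    one_mul, show (2 : ℕ) - 0 = 2 from rfl, constantCoeff_C, constantCoeff_X, map_pow, hw0, hw1, hX2, hX3,
    mul_zero, zero_mul, add_zero] at h
  linear_combination -h

/-- `[t²]D = −a₂ − x₀`. [cite: SilvermanAEC2009, IV.1.1] -/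
theorem coeff_two_translateDen : coeff 2 (W.translateDen x₀) = -W.a₂ - x₀ := by
  simp [translateDen, coeff_two_formalXMulSq', coeff_X_pow, sub_eq_add_neg]

/-- `[t²]N = −a₂`. [cite: SilvermanAEC2009, IV.1.1] -/
theorem coeff_two_translateNum : coeff 2 (W.translateNum y₀) = -W.a₂ := by
  simp [translateNum, coeff_two_formalXMulSq', coeff_X_pow]

/-- `[t¹]u = 0` (`u = 1 + x₀t² + ⋯`). [cite: deShalit1987, II §4.9 (proof of (i))] -/
theorem coeff_one_translateSlopeNum : coeff 1 (W.translateSlopeNum x₀ y₀) = 0 := by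
  have h := congrArg (coeff 1) (W.translateDen_mul_translateSlopeNum x₀ y₀)
  rw [coeff_mul, Finset.Nat.sum_antidiagonal_eq_sum_range_succ_mk, Finset.sum_range_succ, Finset.sum_range_succ,
    Finset.sum_range_zero, zero_add, coeff_one_translateNum] at h
  simp only [Nat.sub_zero, Nat.sub_self, coeff_zero_eq_constantCoeff_apply, constantCoeff_translateDen,
    constantCoeff_translateSlopeNum, coeff_one_translateDen, one_mul, mul_one] at h
  linear_combination h

/-- `[t²]u = x₀`. [cite: deShalit1987, II §4.9 (proof of (i))] -/
theorem coeff_two_translateSlopeNum : coeff 2 (W.translateSlopeNum x₀ y₀) = x₀ := by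
  have h := congrArg (coeff 2) (W.translateDen_mul_translateSlopeNum x₀ y₀)
  rw [coeff_mul, Finset.Nat.sum_antidiagonal_eq_sum_range_succ_mk, Finset.sum_range_succ, Finset.sum_range_succ,
    Finset.sum_range_succ, Finset.sum_range_zero, zero_add, coeff_two_translateNum] at h
  simp only [Nat.sub_zero, Nat.sub_self, Nat.reduceSub, coeff_zero_eq_constantCoeff_apply, constantCoeff_translateDen,
    constantCoeff_translateSlopeNum, coeff_one_translateDen, coeff_one_translateSlopeNum, coeff_two_translateDen, one_mul,
    mul_one, mul_zero, add_zero] at h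
  linear_combination h

/-- `G(0) = 0` (`u(0)² − X(0) = 1 − 1`). [cite: deShalit1987, II §4.9 (proof of (i))] -/
theorem coeff_translateXAux_zero : coeff 0 (W.translateXAux x₀ y₀) = 0 := by
  simp only [translateXAux, map_sub, coeff_zero_eq_constantCoeff_apply, map_pow, map_mul, constantCoeff_C, constantCoeff_X,
    constantCoeff_translateSlopeNum, constantCoeff_formalXMulSq]
  ring

/-- `[t¹]G = 0` (`2u₀u₁ − a₁u₀ − X₁ = −a₁ + a₁`). [cite: deShalit1987, II §4.9 (proof of (i))] -/
theorem coeff_translateXAux_one : coeff 1 (W.translateXAux x₀ y₀) = 0 := by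
  have hu2 : coeff 1 (W.translateSlopeNum x₀ y₀ ^ 2) = 0 := by
    rw [sq, coeff_mul, Finset.Nat.sum_antidiagonal_eq_sum_range_succ_mk, Finset.sum_range_succ, Finset.sum_range_succ,
      Finset.sum_range_zero]
    simp [coeff_one_translateSlopeNum]
  have hXu : coeff 1 (C W.a₁ * X * W.translateSlopeNum x₀ y₀) = W.a₁ := by
    rw [show (1 : ℕ) = 0 + 1 from rfl, mul_assoc, coeff_C_mul, coeff_succ_X_mul, coeff_zero_eq_constantCoeff_apply,
      constantCoeff_translateSlopeNum, mul_one]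
  have hX2 : coeff 1 (C (W.a₂ + x₀) * (X : R⟦X⟧) ^ 2) = 0 := by rw [coeff_C_mul, coeff_X_pow, if_neg (by norm_num), mul_zero]
  rw [translateXAux, map_sub, map_sub, map_sub, hu2, hXu, hX2, coeff_one_formalXMulSq]
  ring

/-- `[t²]G = x₀` (`2u₀u₂ + u₁² − a₁u₁ − X₂ − (a₂ + x₀)`). [cite: deShalit1987, II §4.9 (proof of (i))] -/
theorem coeff_translateXAux_two : coeff 2 (W.translateXAux x₀ y₀) = x₀ := by
  have hu2 : coeff 2 (W.translateSlopeNum x₀ y₀ ^ 2) = 2 * x₀ := by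
    rw [sq, coeff_mul, Finset.Nat.sum_antidiagonal_eq_sum_range_succ_mk, Finset.sum_range_succ, Finset.sum_range_succ,
      Finset.sum_range_succ, Finset.sum_range_zero]
    simp [coeff_one_translateSlopeNum, coeff_two_translateSlopeNum, constantCoeff_translateSlopeNum,
      coeff_zero_eq_constantCoeff_apply]
    ring
  have hXu : coeff 2 (C W.a₁ * X * W.translateSlopeNum x₀ y₀) = 0 := by
    rw [show (2 : ℕ) = 1 + 1 from rfl, mul_assoc, coeff_C_mul, coeff_succ_X_mul, coeff_one_translateSlopeNum, mul_zero]
  rw [translateXAux, map_sub, map_sub, map_sub, hu2, hXu, coeff_two_formalXMulSq', coeff_C_mul, coeff_X_pow, if_pos rfl]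
  ring

/-- ★ **`t² · x(P₀ + P(t)) = u² − a₁tu − X − (a₂ + x₀)t²`** in `R⟦t⟧` (the two lowest coefficients of the right-hand side vanish,
so the division by `t²` is exact). [cite: deShalit1987, II §4.9 Proposition (i) (proof)] [cite: SilvermanAEC2009, III.2.3] -/
theorem X_sq_mul_translateX : X ^ 2 * W.translateX x₀ y₀ = W.translateXAux x₀ y₀ := by
  ext n
  rw [coeff_X_pow_mul']
  split_ifs with h
  · rw [translateX, coeff_mk, Nat.sub_add_cancel h]
  · interval_cases n
    · exact (W.coeff_translateXAux_zero x₀ y₀).symm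
    · exact (W.coeff_translateXAux_one x₀ y₀).symm

/-- ★ **`x(P₀ + P(0)) = x₀`**: the `t`-expansion of `x(P₀ + P(t))` has constant term `x₀`.
[cite: deShalit1987, II §4.9 (proof of (i): «constant term `℘(Ω, L) − ℘(v, L)`»)] -/
theorem constantCoeff_translateX : constantCoeff (W.translateX x₀ y₀) = x₀ := by
  rw [← coeff_zero_eq_constantCoeff_apply, translateX, coeff_mk, zero_add, coeff_translateXAux_two]

/-- `t · H = x(P₀ + P(t)) − x₀`. [cite: deShalit1987, II §4.9 (proof of (i))] -/
theorem X_mul_translateXSubDivX : X * W.translateXSubDivX x₀ y₀ = W.translateX x₀ y₀ - C x₀ := by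
  ext n
  rcases n with _ | n
  · rw [coeff_zero_X_mul, map_sub, coeff_zero_eq_constantCoeff_apply, constantCoeff_translateX, coeff_zero_C, sub_self]
  · rw [coeff_succ_X_mul, translateXSubDivX, coeff_mk, map_sub, coeff_C, if_neg (Nat.succ_ne_zero n), sub_zero]

/-- `y(P₀ + P(t)) = u·H − y₀ − a₁·x(P₀ + P(t)) − a₃` (the definition, for rewriting).
[cite: deShalit1987, II §4.9 (proof of (i))] [cite: SilvermanAEC2009, III.2.3] -/
theorem translateY_def' : W.translateY x₀ y₀ =
    W.translateSlopeNum x₀ y₀ * W.translateXSubDivX x₀ y₀ - C y₀ - C W.a₁ * W.translateX x₀ y₀ - C W.a₃ := rfl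

/-! ### Change of coefficient ring: the `t`-expansions have coefficients in any ring containing `x₀, y₀, aᵢ` -/

section Map

variable {S : Type*} [CommRing S] (φ : R →+* S)

/-- `φ(D) = D` for `W.map φ`, `(φ x₀)`. [cite: deShalit1987, II §4.9 (proof of (i))] -/
theorem map_translateDen : (W.translateDen x₀).map φ = (W.map φ).translateDen (φ x₀) := by
  simp [translateDen, map_formalXMulSq]

/-- `φ(N) = N`. [cite: deShalit1987, II §4.9 (proof of (i))] -/
theorem map_translateNum : (W.translateNum y₀).map φ = (W.map φ).translateNum (φ y₀) := by
  simp [translateNum, map_formalXMulSq]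

/-- `φ(u) = u`. [cite: deShalit1987, II §4.9 (proof of (i))] -/
theorem map_translateSlopeNum : (W.translateSlopeNum x₀ y₀).map φ = (W.map φ).translateSlopeNum (φ x₀) (φ y₀) := by
  rw [translateSlopeNum, translateSlopeNum, map_mul, map_translateNum,
    Literature.NumberTheory.EllipticCurves.map_invOfUnit_one φ _ (W.constantCoeff_translateDen x₀), map_translateDen]

/-- `φ(G) = G`. [cite: deShalit1987, II §4.9 (proof of (i))] -/
theorem map_translateXAux : (W.translateXAux x₀ y₀).map φ = (W.map φ).translateXAux (φ x₀) (φ y₀) := by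
  simp [translateXAux, map_translateSlopeNum, map_formalXMulSq]

/-- ★ **`φ(x(P₀ + P(t))) = x(φP₀ + P(t))`**: the `t`-expansion of the `x`-coordinate of the translate commutes with ring maps —
over a subring `R ⊂ K` (e.g. the localisation at `𝔓`) containing `x₀, y₀` and the `aᵢ`, the expansion computed over `K` has
coefficients in `R`. [cite: deShalit1987, II §4.9 Proposition (i)] -/
theorem map_translateX : (W.translateX x₀ y₀).map φ = (W.map φ).translateX (φ x₀) (φ y₀) := by
  ext n
  rw [coeff_map, translateX, translateX, coeff_mk, coeff_mk, ← coeff_map, map_translateXAux]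

/-- `φ(H) = H`. [cite: deShalit1987, II §4.9 (proof of (i))] -/
theorem map_translateXSubDivX : (W.translateXSubDivX x₀ y₀).map φ = (W.map φ).translateXSubDivX (φ x₀) (φ y₀) := by
  ext n
  rw [coeff_map, translateXSubDivX, translateXSubDivX, coeff_mk, coeff_mk, ← coeff_map, map_translateX]

/-- ★ **`φ(y(P₀ + P(t))) = y(φP₀ + P(t))`** (integrality of the `y`-expansion likewise).
[cite: deShalit1987, II §4.9 Proposition (i)] -/
theorem map_translateY : (W.translateY x₀ y₀).map φ = (W.map φ).translateY (φ x₀) (φ y₀) := by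
  simp [translateY, map_translateSlopeNum, map_translateXSubDivX, map_translateX]

end Map

end WeierstrassCurve
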